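import Summits.ValiantsHypothesis.ValiantsHypothesis.Theorems.LacunarySymmetroidMatrixDescartesCensusCUSoundCerts

/-!
# `MatrixDescartes` census — soundness of the chamber-uniform checker, part 4b: competitors, domination, certificates

HONEST FRAMING.  Object-search cell `pub-symmetroid`; door-A item `DoorA26 = PosRootLawAt 2 6 19`
(stmt-ValiantsHypothesis-19979; OPEN, typed, never asserted).  Continuation of `…CensusCUSoundCerts`: `CU.compOK_sound`
(`|t_k| · ud ≤ un · |t_{n0}|`); `CU.domOK_sound` (an inequality `≥ 0` with a dominated negative term, or a vanishing rank row with a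
dominated term, is contradictory); `CU.certOK_sound` (odd triangles, domination, pure LP, exponent splits, magnitude splits — by
recursion on the certificate, carrying the two contexts).  All relative to a `CU.Model` on a support `d` of the chamber.  Nothing here
bears on `V = 19`, on `DoorA26` itself (OPEN), on `MatrixDescartes` (stmt-ValiantsHypothesis-18050) or on `VP ≠ VNP`.

[folklore] Certificate-checker soundness; elementary.
-/

-- the D-0017 layout repeats a namespace component (single-conjunct summit); the `dupNamespace` linter flags it; name mandated.
set_option linter.dupNamespace false

namespace Summit.ValiantsHypothesis.ValiantsHypothesis.Theorems.LacunarySymmetroidMatrixDescartes.Census.CU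

open V20 (Atom Term PolySpec allAtoms posOf qA cA termNeg posTerms posl negAt fval Row RowSpec buildRow lprod pval tval sgnR
  Epos sums dist1 ordOK psum)
open Finset

variable {ord : List Atom} {s : Bool} {x : ℕ → ℝ} {v : Atom → ℝ} (d : Fin 6 → ℕ)

/-! ## Competitors -/

/-- `vdot` of a competitor's target vector is the difference of the log-monomials. [folklore] -/
theorem vdot_target {dl : List ℕ} (M : V20.Model dl ord s x v) {Tk T0 : Term} (hk : ∀ a ∈ Tk.2, a ∈ allAtoms) (h0 : ∀ a ∈ T0.2, a ∈ allAtoms) :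
    vdot (vbumps (vbumps z21 (posl ord Tk.2) 1) (posl ord T0.2) (-1)) (ell x)
      = Real.log (lprod x (posl ord Tk.2)) - Real.log (lprod x (posl ord T0.2)) := by
  rw [vdot_vbumps _ _ _ _ (fun p hp => by rw [length_vbumps, length_z21]; exact V20.posl_lt_21 M h0 p hp),
    vdot_vbumps _ _ _ _ (fun p hp => by rw [length_z21]; exact V20.posl_lt_21 M hk p hp), vdot_z21,
    log_lprod M.xpos, log_lprod M.xpos]
  push_cast; ring

/-- **One competitor**: `|t_k| · ud ≤ un · |t_{n0}|`. [folklore] -/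
theorem compOK_sound (hordA : ordAtomsOK ord = true) (M : Model (dlist d) ord s x v)
    {ctx : List LinD} (hctx : ∀ G ∈ ctx, 0 ≤ G.ev d) {ctxL : List LRow} (hctxL : ∀ r ∈ ctxL, r.Holds (ell x) ∧ r.WF)
    {P : List Term} (hP : ∀ T ∈ P, ∀ a ∈ T.2, a ∈ allAtoms) (hP0 : ∀ T ∈ P, T.1 ≠ 0)
    {n0 ud : ℕ} (hn0 : n0 < P.length) (hud : 0 < ud) {c : Comp} (hk : c.k < P.length)
    (h : compOK ctx ctxL ord s P n0 ud c = true) :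
    |tval v (P.getD c.k (0, []))| * ud ≤ c.un * |tval v (P.getD n0 (0, []))| := by
  have MV := M.toV20
  unfold compOK at h
  dsimp only at h
  split at h
  · simp at h
  · next q hq =>
    simp only [Bool.and_eq_true, decide_eq_true_eq] at h
    obtain ⟨⟨hD, hun⟩, hle⟩ := h
    have hT0a := hP _ (V20.term_getD_mem P hn0)
    have hTka := hP _ (V20.term_getD_mem P hk)
    have hg0 : (P.getD n0 (0, [])).1 ≠ 0 := hP0 _ (V20.term_getD_mem P hn0)
    have hgk : (P.getD c.k (0, [])).1 ≠ 0 := hP0 _ (V20.term_getD_mem P hk)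
    obtain ⟨hb, hqpos⟩ := boundConst_sound d hordA M hctx hctxL (by rw [length_vbumps, length_vbumps, length_z21]) hq
    rw [vdot_target MV hTka hT0a] at hb
    rw [V20.abs_tval_eq MV.xpos MV.hv _ hT0a, V20.abs_tval_eq MV.xpos MV.hv _ hTka]
    set G0 : ℝ := |((P.getD n0 (0, [])).1 : ℝ)| with hG0
    set Gk : ℝ := |((P.getD c.k (0, [])).1 : ℝ)| with hGk
    set m0 := lprod x (posl ord (P.getD n0 (0, [])).2) with hm0
    set mk := lprod x (posl ord (P.getD c.k (0, [])).2) with hmk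
    have hm0p : 0 < m0 := V20.lprod_pos MV.xpos _
    have hmkp : 0 < mk := V20.lprod_pos MV.xpos _
    have hG0p : 0 < G0 := by rw [hG0]; exact abs_pos.2 (by exact_mod_cast hg0)
    have hGkp : 0 < Gk := by rw [hGk]; exact abs_pos.2 (by exact_mod_cast hgk)
    have hudR : (0 : ℝ) < ud := by exact_mod_cast hud
    have hunR : (0 : ℝ) < c.un := by exact_mod_cast hun
    have hDR : (0 : ℝ) < c.D := by exact_mod_cast hD
    -- the rational comparison, in logarithms
    have hleR : ((Gk / G0) ^ c.D * (q : ℝ)) * (ud : ℝ) ^ c.D ≤ (c.un : ℝ) ^ c.D := by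
      have := (Rat.cast_le (K := ℝ)).2 hle
      push_cast at this
      rw [Nat.cast_natAbs, Nat.cast_natAbs, Int.cast_abs, Int.cast_abs] at this
      exact this
    have hlog2 := Real.log_le_log (by positivity) hleR
    rw [Real.log_mul (by positivity) (by positivity), Real.log_mul (by positivity) (by positivity), Real.log_pow,
      Real.log_pow, Real.log_pow, Real.log_div hGkp.ne' hG0p.ne'] at hlog2
    -- conclude
    have key : Real.log (mk * Gk * ud) ≤ Real.log (m0 * c.un * G0) := by
      rw [Real.log_mul (by positivity) hudR.ne', Real.log_mul hmkp.ne' hGkp.ne', Real.log_mul (by positivity) hG0p.ne',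
        Real.log_mul hm0p.ne' hunR.ne']
      have h3 : (c.D : ℝ) * (Real.log mk + Real.log Gk + Real.log ud)
          ≤ (c.D : ℝ) * (Real.log m0 + Real.log c.un + Real.log G0) := by nlinarith
      exact le_of_mul_le_mul_left h3 hDR
    have := (Real.log_le_log_iff (by positivity) (by positivity)).1 key
    nlinarith

/-! ## Domination -/

/-- The identity an accepted domination certificate names holds in the model: `≥ 0`, or `= 0` for a rank row. [folklore] -/
theorem pspec_holds {dl : List ℕ} (M : Model dl ord s x v) {P : PSpec} (hval : P.valid = true) (hdef : P.defOK ord s = true) :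
    (P.isEq = false → 0 ≤ pval v P.poly) ∧ (P.isEq = true → pval v P.poly = 0) := by
  cases P with
  | ineq Q =>
    refine ⟨fun _ => V20.pval_nonneg M.toV20 Q hval fun i j hij => ?_, fun h => by simp [PSpec.isEq] at h⟩
    subst hij; simpa [PSpec.defOK, V20.PolySpec.defOK] using hdef
  | m4 r c =>
    refine ⟨fun h => by simp [PSpec.isEq] at h, fun _ => ?_⟩
    simp only [PSpec.valid, Bool.and_eq_true, decide_eq_true_eq] at hval
    obtain ⟨⟨⟨hr, hc⟩, hr6⟩, hc6⟩ := hval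
    exact M.m4 r c hr hc hr6 hc6

/-- **An accepted domination certificate refutes the model.** [folklore] -/
theorem domOK_sound (hordA : ordAtomsOK ord = true) (M : Model (dlist d) ord s x v)
    {ctx : List LinD} (hctx : ∀ G ∈ ctx, 0 ≤ G.ev d) {ctxL : List LRow} (hctxL : ∀ r ∈ ctxL, r.Holds (ell x) ∧ r.WF)
    {P : PSpec} {n0 ud : ℕ} {comps : List Comp} (h : domOK ctx ctxL ord s P n0 ud comps = true) : False := by
  classical
  have MV := M.toV20
  unfold domOK at h
  simp only [Bool.and_eq_true, decide_eq_true_eq, List.all_eq_true, Bool.or_eq_true] at h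
  obtain ⟨⟨⟨⟨⟨⟨⟨⟨⟨⟨⟨hval, hdef⟩, hn0⟩, hneg⟩, hud⟩, hnz⟩, hatoms⟩, hcov⟩, hmem⟩, hnd⟩, hsum⟩, hall⟩ := h
  set poly := P.poly with hpoly
  set need := (if P.isEq then (List.range poly.length).filter (· ≠ n0) else posTerms ord s poly) with hneed
  set w : ℕ → ℝ := fun n => tval v (poly.getD n (0, [])) with hw
  have hT0a := hatoms _ (V20.term_getD_mem poly hn0)
  have hg0 : (poly.getD n0 (0, [])).1 ≠ 0 := hnz _ (V20.term_getD_mem poly hn0)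
  have hw0 : 0 < |w n0| := by
    simp only [hw]
    rw [V20.abs_tval_eq MV.xpos MV.hv _ hT0a]
    exact mul_pos (abs_pos.2 (by exact_mod_cast hg0)) (V20.lprod_pos MV.xpos _)
  have hneedlt : ∀ k ∈ need, k < poly.length := by
    intro k hk
    simp only [hneed] at hk
    split_ifs at hk
    · exact List.mem_range.1 (List.mem_filter.1 hk).1
    · unfold posTerms at hk; exact List.mem_range.1 (List.mem_filter.1 hk).1
  have hklt : ∀ c ∈ comps, c.k < poly.length := fun c hc => hneedlt _ (hmem c hc)
  -- (1) the competitors' bounds add up to `Σ |w c.k| < |w n0|`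
  have hbounds : (comps.map fun c => |w c.k| * ud).sum ≤ (comps.map fun c => (c.un : ℝ) * |w n0|).sum :=
    List.sum_le_sum fun c hc => compOK_sound d hordA M hctx hctxL hatoms hnz hn0 hud (hklt c hc) (hall c hc)
  have hsumR : ((comps.map Comp.un).sum : ℝ) < ud := by exact_mod_cast hsum
  have hlt : (comps.map fun c => |w c.k|).sum < |w n0| := by
    have e1 : (comps.map fun c => |w c.k| * ud).sum = (comps.map fun c => |w c.k|).sum * ud := by
      rw [List.sum_map_mul_right]
    have e2 : (comps.map fun c => (c.un : ℝ) * |w n0|).sum = ((comps.map Comp.un).sum : ℝ) * |w n0| := by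
      push_cast; rw [List.map_map, ← List.sum_map_mul_right]; rfl
    rw [e1, e2] at hbounds
    have hudR : (0 : ℝ) < ud := by exact_mod_cast hud
    nlinarith
  -- (2) the needed terms are covered: `Σ_{n ∈ need} |w n| ≤ Σ_{comps} |w c.k|`
  have hneedle : ∑ n ∈ need.toFinset, |w n| ≤ (comps.map fun c => |w c.k|).sum := by
    have hsub2 : need.toFinset ⊆ (comps.map Comp.k).toFinset := by
      intro n hn
      rw [List.mem_toFinset] at hn
      obtain ⟨c, hc, hck⟩ := hcov n hn
      rw [List.mem_toFinset, List.mem_map]; exact ⟨c, hc, hck⟩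
    calc ∑ n ∈ need.toFinset, |w n| ≤ ∑ n ∈ (comps.map Comp.k).toFinset, |w n| :=
          Finset.sum_le_sum_of_subset_of_nonneg hsub2 fun n _ _ => abs_nonneg _
      _ = ((comps.map Comp.k).map fun n => |w n|).sum := List.sum_toFinset _ hnd
      _ = (comps.map fun c => |w c.k|).sum := by rw [List.map_map]; rfl
  -- (3) the identity
  have hpv : pval v poly = ∑ n ∈ Finset.range poly.length, w n := V20.pval_eq_sum_range v poly
  obtain ⟨hineq, heq⟩ := pspec_holds M hval hdef
  cases hP : P.isEq with
  | true =>
    -- rank row: `0 = Σ w`, so `|w n0| ≤ Σ_{n ≠ n0} |w n|`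
    have h0 : ∑ n ∈ Finset.range poly.length, w n = 0 := by rw [← hpv]; exact heq hP
    have hneedT : need.toFinset = (Finset.range poly.length).erase n0 := by
      simp only [hneed, hP, if_true]
      ext n; simp [Finset.mem_erase, and_comm]
    rw [← Finset.add_sum_erase _ _ (Finset.mem_range.2 hn0)] at h0
    have h1 : |w n0| ≤ ∑ n ∈ (Finset.range poly.length).erase n0, |w n| := by
      have : w n0 = -∑ n ∈ (Finset.range poly.length).erase n0, w n := by linarith
      rw [this, abs_neg]; exact Finset.abs_sum_le_sum_abs _ _
    rw [← hneedT] at h1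
    linarith
  | false =>
    have hP0 : 0 ≤ pval v poly := hineq hP
    simp only [hP, Bool.false_eq_true, false_or] at hneg
    have hneedF : need = posTerms ord s poly := by simp [hneed, hP]
    set posS := (posTerms ord s poly).toFinset with hposS
    have hposSub : posS ⊆ Finset.range poly.length := by
      intro n hn
      rw [hposS, List.mem_toFinset] at hn
      unfold posTerms at hn
      exact Finset.mem_range.2 (List.mem_range.1 (List.mem_filter.1 hn).1)
    have hrest : ∀ n ∈ Finset.range poly.length \ posS, w n ≤ 0 := by
      intro n hn
      rw [Finset.mem_sdiff, Finset.mem_range, hposS, List.mem_toFinset] at hn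
      have htn : termNeg ord s (poly.getD n (0, [])) = true := by
        have := (V20.mem_posTerms_iff (ord := ord) (s := s) hn.1).not.1 hn.2
        simpa using this
      exact V20.tval_nonpos_of_termNeg MV.xpos MV.hv _ (hatoms _ (V20.term_getD_mem poly hn.1)) htn
    have hn0rest : n0 ∈ Finset.range poly.length \ posS := by
      rw [Finset.mem_sdiff, Finset.mem_range, hposS, List.mem_toFinset]
      refine ⟨hn0, fun hm => ?_⟩
      have := (V20.mem_posTerms_iff (ord := ord) (s := s) hn0).1 hm
      rw [this] at hneg
      exact Bool.false_ne_true hneg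
    have hsplit : pval v poly = ∑ n ∈ posS, w n + ∑ n ∈ Finset.range poly.length \ posS, w n := by
      rw [hpv, ← Finset.sum_sdiff hposSub, add_comm]
    have hrestle : ∑ n ∈ Finset.range poly.length \ posS, w n ≤ w n0 := by
      rw [← Finset.add_sum_erase _ _ hn0rest]
      have : ∑ n ∈ (Finset.range poly.length \ posS).erase n0, w n ≤ 0 :=
        Finset.sum_nonpos fun n hn => hrest n (Finset.mem_of_mem_erase hn)
      linarith
    have hposle : ∑ n ∈ posS, w n ≤ (comps.map fun c => |w c.k|).sum := by
      rw [hneedF] at hneedle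
      exact (Finset.sum_le_sum fun n _ => le_abs_self (w n)).trans hneedle
    have hw0le : w n0 ≤ 0 := hrest n0 hn0rest
    have : |w n0| = -w n0 := abs_of_nonpos hw0le
    linarith

/-! ## Certificates -/

/-- **Soundness of the certificate checker (abstract form)**: no model on a support where the exponent context is non-negative and the
magnitude context holds passes an accepted certificate. [folklore] -/
theorem certOK_sound (hordA : ordAtomsOK ord = true) (M : Model (dlist d) ord s x v) :
    ∀ (c : Cert) (ctx : List LinD) (ctxL : List LRow), (∀ G ∈ ctx, 0 ≤ G.ev d) → (∀ r ∈ ctxL, r.Holds (ell x) ∧ r.WF) →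
      certOK ord s ctx ctxL c = true → False
  | .sign i j k, ctx, ctxL, _, _, h => V20.signOK_sound M.toV20 h
  | .dom P n0 ud comps, ctx, ctxL, hctx, hctxL, h => domOK_sound d hordA M hctx hctxL h
  | .lp rows abel arcs, ctx, ctxL, hctx, hctxL, h => by
    unfold certOK at h
    split at h
    · next q hq =>
      simp only [decide_eq_true_eq] at h
      obtain ⟨hb, hqpos⟩ := boundConst_sound d hordA M hctx hctxL length_z21 hq
      rw [vdot_z21, mul_zero] at hb
      have : Real.log (q : ℝ) < 0 := Real.log_neg (by exact_mod_cast hqpos) (by exact_mod_cast h)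
      linarith
    · simp at h
  | .splitD hF cp cn, ctx, ctxL, hctx, hctxL, h => by
    unfold certOK at h
    simp only [Bool.and_eq_true] at h
    obtain ⟨hp, hn⟩ := h
    rcases le_total 0 (hF.ev d) with hle | hle
    · exact certOK_sound hordA M cp (ctx ++ [hF]) ctxL
        (fun G hG => by
          rcases List.mem_append.1 hG with hG | hG
          · exact hctx G hG
          · simp at hG; rw [hG]; exact hle) hctxL hp
    · exact certOK_sound hordA M cn (ctx ++ [ldSmul (-1) hF]) ctxL
        (fun G hG => by
          rcases List.mem_append.1 hG with hG | hG
          · exact hctx G hG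
          · simp at hG; rw [hG, ev_ldSmul]; linarith) hctxL hn
  | .splitL w kn kd cle cge, ctx, ctxL, hctx, hctxL, h => by
    unfold certOK at h
    simp only [Bool.and_eq_true, decide_eq_true_eq] at h
    obtain ⟨⟨⟨⟨hw, hkn⟩, hkd⟩, hle⟩, hge⟩ := h
    rcases le_total (vdot w (ell x)) (Real.log ((kn : ℝ) / kd)) with hc | hc
    · exact certOK_sound hordA M cle ctx (ctxL ++ [⟨w, kn, kd⟩]) hctx
        (fun r hr => by
          rcases List.mem_append.1 hr with hr | hr
          · exact hctxL r hr
          · simp at hr; subst hr; exact ⟨hc, hkn, hkd, hw⟩) hle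
    · exact certOK_sound hordA M cge ctx (ctxL ++ [⟨vSmul (-1) w, kd, kn⟩]) hctx
        (fun r hr => by
          rcases List.mem_append.1 hr with hr | hr
          · exact hctxL r hr
          · simp at hr; subst hr
            refine ⟨?_, hkd, hkn, by simp [length_vSmul, hw]⟩
            unfold LRow.Holds
            simp only
            rw [vdot_vSmul]
            have hknR : (0 : ℝ) < kn := by exact_mod_cast hkn
            have hkdR : (0 : ℝ) < kd := by exact_mod_cast hkd
            rw [Real.log_div hkdR.ne' hknR.ne']
            rw [Real.log_div hknR.ne' hkdR.ne'] at hc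
            push_cast; linarith) hge

end Summit.ValiantsHypothesis.ValiantsHypothesis.Theorems.LacunarySymmetroidMatrixDescartes.Census.CU
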